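import Summits.BirchSwinnertonDyer.BirchSwinnertonDyer.Theorems.KatoDescentPotSupersingularFineSelmerLeSignedSelmerTools
import Literature.NumberTheory.EllipticCurves.Greenberg1999.ControlLocalKernelsLayerGoodProofs
import Literature.NumberTheory.EllipticCurves.SelmerCorankControlRatProofs
import Literature.NumberTheory.EllipticCurves.KatoFineSelmerFiniteProofs
import Summits.BirchSwinnertonDyer.Rank1Residual.Iwasawa.DualPairFiniteResidue
import Summits.BirchSwinnertonDyer.Rank1Residual.Iwasawa.MuZeroQuotientCard
import Summits.BirchSwinnertonDyer.Rank1Residual.X2.NonPrimitiveSelmerTorsionCard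
import HarnessLib

/-!
# The fine Selmer group lies in Kobayashi's SIGNED Selmer groups over a `ℤ_p`-extension:
# `Sel₀(K_∞, E[p^∞]) ≤ Sel^±(E/K_∞) = ⋃ₙ res Sel^±(E/K_n)` — the "± ⊇ fine" kernel bridge of the
# SUPERSINGULAR-anchor road to crux stmt-BirchSwinnertonDyer-19386 (route `KatoDescentPotSupersingular`,
# rung K9, cell `bsd-potss`; a `--supports … --as helper` file; seat `bsd-potss-k9-c4` g5; ROUTE-FREE;
# nothing booked, BSD is not proved by any of this)

WHY. The congruence road to Coates–Sujatha's (A) on a ♯ row `W` of the crux (`W[3]` irreducible,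
3-adic tower not onto) needs (A) at ONE `E[3]`-congruent anchor `W′` (Lim–Sujatha 2018 Prop. 3.2,
tree fact p445851). On the 3Nn Cartan rows (95 of the 163 ♯ rows) `3` is inert in the CM field of
every CM partner, so the anchors are GOOD SUPERSINGULAR at `3` (`a₃ = 0`): their cyclotomic Iwasawa
theory is Kobayashi's `Sel^±` / Pollack–Rubin's signed main conjecture (tree fact
`PollackRubin2004.mainTheorem_signedCharIdeal_eq_of_cm`), which certify "`Sel^±(W′/ℚ_∞)[p]` finite"
(`μ(L_p^∓) = 0`), NOT "`Sel(W′/ℚ_∞)[p]` finite" (the classical Selmer group has `Λ`-corank one there).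
To feed such a certificate into the kernel road of seats g3/g4 (`conjA_of_finite_selmerInfty_pTorsion`:
`Sel₀ ≤ Sel`, `Sel[p]` finite ⟹ (A)) one needs the containment of the FINE Selmer group in the SIGNED
one, proved here from the tools of the sibling `…FineSelmerLeSignedSelmerTools.lean`:

* §5 **`fineSelmerInfty_le_signedSelmerInfty`**: for `W/K` elliptic over a number field, `p`, ANY
  `ℤ_p`-extension `κ`, ANY sign `ε`, and a finite set `S` of finite places off which `W` has good
  reduction and `v ∤ p`: `W.fineSelmerInfty κ ≤ Kobayashi2003.signedSelmerInfty W κ ε`. Proof: for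
  `c ∈ Sel₀(K_∞)` pick `c = h_n(y)` (§1); at the finitely many `(v ∈ S, i < p^n)` the classical and
  (for `v ∣ p`) the fine local conditions of `conj_{γ^i} c` descend to a common layer `m` (§3); at good
  `v ∉ S` they hold at every layer by Greenberg's Lemma 3.3 (`localTowerKerPrimary_eq_bot_of_hasGoodReductionAt`,
  classes being `p`-power torsion, `exists_pow_smul_subgroupH1_layer_eq_zero`) and at `∞` because archimedean places split completely
  (`localTowerKer_eq_bot_of_forall_mem`); so `res_{K_m} y ∈ Sel^ε(E/K_m)` (§4: its signed Kummer
  conditions hold with TORSION witnesses) and `c = h_m(res y)`.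
* §6 consequences for the road: `finite_fineSelmerInfty_pTorsion_of_finite_signedSelmerInfty_pTorsion`,
  the anchor-type-free step `conjA_of_finite_fineSelmerInfty_pTorsion` (`Sel₀[p]` finite ⟹ (A)), and
  **`conjA_of_finite_signedSelmerInfty_pTorsion`** — (A) at `(W′,p)` over `K_∞` (the tree's
  `∃`-form `Module.Finite ℤ_[p] X₀`) as soon as `Sel^ε(W′/K_∞)[p]` is finite for ONE sign `ε`
  (signed `μ = 0` with cotorsion); `conjA_rat_of_finite_signedSelmerInfty_pTorsion` (over `ℚ`, all
  cyclotomic `κ`). This is the entry point for CM-supersingular anchors (Pollack–Rubin + a unit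
  coefficient of `L_p^∓`) on the 3Nn rows of 19386, twin of g4's ordinary `…OrdinaryUnitAnchor` file.

HONEST FRAMING: kernel plumbing between existing tree objects; unconditional; no named fact, no
definition; no item closed (19386/19197 stay open; class-wide = Coates–Sujatha (A), a named open
problem); no census number is an input. References: S. Kobayashi, Invent. Math. 152 (2003) Def. 1.1,
Def. 2.1, Thm. 1.2 [Kobayashi2003]; J. Coates, R. Sujatha, Math. Ann. 331 (2005) §3 [CoatesSujatha2005];
R. Greenberg, LNM 1716 (1999) §3 Lemmas 3.2–3.3, pp. 85–90 [GreenbergLNM1716]; J.-P. Serre, *Galois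
Cohomology* I.§2.2 Prop. 8 [SerreGaloisCohomology1997]; R. Pollack, K. Rubin, Ann. of Math. 159 (2004)
[PollackRubin2004].
-/

set_option autoImplicit false
-- sibling precedent (`KatoDescentPotSupersingularAssembly.lean`): the directory name repeats the summit name
set_option linter.dupNamespace false

noncomputable section

open scoped Classical

universe u

namespace Summit.BirchSwinnertonDyer.BirchSwinnertonDyer.Theorems.FineSelmerLeSignedSelmer

open CategoryTheory NumberField IsDedekindDomain Field
open Literature.NumberTheory.EllipticCurves Literature.NumberTheory.EllipticCurves.GreenbergSelmer
  Literature.NumberTheory.EllipticCurves.Kobayashi2003 Literature.NumberTheory.EllipticCurves.ZpExtension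
  Literature.NumberTheory.GaloisRepresentations
  Summit.BirchSwinnertonDyer.Rank1Residual.Additive
  Summit.BirchSwinnertonDyer.BirchSwinnertonDyer.Theorems

/-! ## §5 `Sel₀(K_∞, E[p^∞]) ≤ Sel^ε(E/K_∞)` -/

section Main

variable {K : Type u} [Field K] [NumberField K] (W : WeierstrassCurve K) {p : ℕ} [Fact p.Prime]
  (κ : ZpExtension K p)

omit [NumberField K] in
/-- Localisation commutes with restriction down the layers (pointwise `localResOverOfEmb_resOfLe` at
the chosen embedding). [cite: GreenbergLNM1716, §3 p. 86] -/
theorem localResOver_resOfLe_layer {n m : ℕ} (hnm : n ≤ m) (E : Type u) [Field E] [Algebra K E]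
    (y : W.subgroupH1 p (κ.layerSubgroup n)) :
    W.localResOver p (κ.layerSubgroup m) E (W.resOfLe p (κ.layerSubgroup_antitone hnm) y) =
      Literature.NumberTheory.EllipticCurves.resOfLe (localPoints W E)
        (Subgroup.comap_mono (κ.layerSubgroup_antitone hnm) :
          localSubgroup (κ.layerSubgroup m) E ≤ localSubgroup (κ.layerSubgroup n) E)
        (W.localResOver p (κ.layerSubgroup n) E y) :=
  W.localResOverOfEmb_resOfLe p (closureEmb (K := K) E) (κ.layerSubgroup_antitone hnm) y

omit [NumberField K] in
/-- `conj_σ` commutes with restriction down the layers (pointwise `resOfLe_comp_conjH1`). [folklore] -/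
theorem conjH1_resOfLe_layer {n m : ℕ} (hnm : n ≤ m) (σ : absoluteGaloisGroup K)
    (y : W.subgroupH1 p (κ.layerSubgroup n)) :
    W.conjH1 p (κ.layerSubgroup m) σ (W.resOfLe p (κ.layerSubgroup_antitone hnm) y) =
      W.resOfLe p (κ.layerSubgroup_antitone hnm) (W.conjH1 p (κ.layerSubgroup n) σ y) := by
  have h := congrArg (fun f ↦ f y)
    (resOfLe_comp_conjH1_holds (M := W.geomPrimaryTorsion p) (κ.layerSubgroup_antitone hnm) σ)
  simp only [AddMonoidHom.coe_comp, Function.comp_apply] at h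
  exact h.symm

omit [NumberField K] in
/-- `h_m (res_{K_m/K_n} y) = h_n y` (transitivity of restriction). [folklore] -/
theorem layerToInfty_resOfLe_layer {n m : ℕ} (hnm : n ≤ m) (y : W.subgroupH1 p (κ.layerSubgroup n)) :
    W.layerToInfty κ m (W.resOfLe p (κ.layerSubgroup_antitone hnm) y) = W.layerToInfty κ n y := by
  have h := congrArg (fun f ↦ f y)
    (W.resOfLe_comp_holds p (κ.kerSubgroup_le_layerSubgroup m) (κ.layerSubgroup_antitone hnm))
  simp only [AddMonoidHom.coe_comp, Function.comp_apply] at h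
  exact h

/-- The fine condition of `c = h_n(y)` at `v ∣ p`, conjugated by `σ`, read at layer `n`: the class
`conj_σ y` vanishes on `Gal(K̄/K_∞) ⊓ D_v` (hypothesis `hx` of `exists_forall_resOfLe_inf_decomp_eq_zero`).
[cite: Greenberg1989, §1 p. 98] [cite: CoatesSujatha2005, §3] -/
theorem resOfLe_ker_inf_decomp_conjH1_eq_zero_of_mem_fineSelmerInfty {n : ℕ}
    {y : W.subgroupH1 p (κ.layerSubgroup n)} (hc : W.layerToInfty κ n y ∈ W.fineSelmerInfty κ)
    (v : HeightOneSpectrum (𝓞 K)) (hv : ((p : ℕ) : 𝓞 K) ∈ v.asIdeal) (σ : absoluteGaloisGroup K) :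
    W.resOfLe p (inf_le_left.trans (κ.kerSubgroup_le_layerSubgroup n) :
      κ.kerSubgroup ⊓ decomp v ≤ κ.layerSubgroup n) (W.conjH1 p (κ.layerSubgroup n) σ y) = 0 := by
  have hc' := (mem_strictSelmerGroupOver_iff (H := κ.kerSubgroup) (M := W.geomPrimaryTorsion p)
    (L := fineData (W.geomPrimaryTorsion p) p) (W.layerToInfty κ n y)).1 hc
  have h1 : W.resOfLe p (inf_le_left : κ.kerSubgroup ⊓ decomp v ≤ κ.kerSubgroup)
      (W.conjH1 p κ.kerSubgroup σ (W.layerToInfty κ n y)) = 0 :=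
    resOfLe_inf_decomp_eq_zero_of_mem_strictKer_fineLocalDatum W p κ.kerSubgroup v (hc'.2.2 v hv σ)
  rw [← W.layerToInfty_conjH1 κ σ y] at h1
  have h2 := congrArg (fun f ↦ f (W.conjH1 p (κ.layerSubgroup n) σ y))
    (W.resOfLe_comp_holds p (inf_le_left : κ.kerSubgroup ⊓ decomp v ≤ κ.kerSubgroup)
      (κ.kerSubgroup_le_layerSubgroup n))
  simp only [AddMonoidHom.coe_comp, Function.comp_apply] at h2
  rw [← h2]
  exact h1

/-- **The fine Selmer group lies in Kobayashi's signed Selmer group over `K_∞`, for every sign.**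
Let `W/K` be an elliptic curve over a number field, `p` a prime, `κ` ANY `ℤ_p`-extension of `K`,
`ε = ±1`, and `S` a finite set of finite places such that every `v ∉ S` has `v ∤ p` and good
reduction. Then `Sel₀(K_∞, E[p^∞]) ≤ Sel^ε(E/K_∞)`:
`W.fineSelmerInfty κ ≤ Kobayashi2003.signedSelmerInfty W κ ε` (the right-hand side being the union
of the images of the layer groups `Sel^ε(E/K_n)`, Def. 1.1). Proof (module docstring): `c = h_n(y)`
(§1); the classical and fine local conditions of the `p^n` conjugates `conj_{γ^i} c` at the places of
`S` descend to one layer `m ≥ n` (§3); off `S` and at `∞` they hold at every layer (Greenberg's Lemma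
3.3, archimedean splitting); so `res_{K_m/K_n} y ∈ Sel^ε(E/K_m)` (its signed Kummer conditions hold
with torsion witnesses, §4) and `c = h_m(res y)`. "`Sel₀ ⊆ Sel^±`".
[cite: Kobayashi2003, Def. 1.1 (p. 2), Def. 2.1 (p. 5)] [cite: CoatesSujatha2005, §3]
[cite: GreenbergLNM1716, §3 Lemmas 3.2–3.3 (pp. 86–88) and p. 90] -/
theorem fineSelmerInfty_le_signedSelmerInfty [W.IsElliptic] (S : Finset (HeightOneSpectrum (𝓞 K)))
    (hS : ∀ v ∉ S, ((p : ℕ) : 𝓞 K) ∉ v.asIdeal ∧ W.HasGoodReductionAt v) (ε : ℤˣ) :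
    W.fineSelmerInfty κ ≤ signedSelmerInfty W κ ε := by
  intro c hc
  -- §1: `c = h_n(y)`; a topological generator `γ`
  obtain ⟨n, y, rfl⟩ := exists_layerToInfty_eq W κ c
  obtain ⟨γ, hγ⟩ := κ.surjective (Multiplicative.ofAdd 1)
  have hγ' : κ.IsTopGenerator γ := hγ
  have hsel : W.layerToInfty κ n y ∈ W.selmerInfty κ :=
    FineSelmerLeSelmer.fineSelmerInfty_le_selmerInfty W κ hc
  have hyA : y ∈ W.selmerInftyPreimage κ n := (W.mem_selmerInftyPreimage_iff κ n y).2 hsel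
  -- §3 (classical coefficients) at the places of `S`, for the `p^n` conjugates `conj_{γ^i} y`
  have hcl := fun (vi : ↥S × Fin (p ^ n)) ↦
    exists_forall_resOfLe_localSubgroup_eq_zero_of_mem_localTowerKer W κ (vi.1.1.adicCompletion K) n
      (W.localResOver_conjH1_mem_localTowerKer_of_mem κ hyA vi.1.1 (γ ^ (vi.2 : ℕ)))
  choose mc hmc using hcl
  -- §3 (torsion coefficients) at the places of `S` above `p`, for the same conjugates
  have hfi := fun (vi : {v : ↥S // ((p : ℕ) : 𝓞 K) ∈ v.1.asIdeal} × Fin (p ^ n)) ↦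
    exists_forall_resOfLe_inf_decomp_eq_zero W κ vi.1.1.1 n
      (resOfLe_ker_inf_decomp_conjH1_eq_zero_of_mem_fineSelmerInfty W κ hc vi.1.1.1 vi.1.2
        (γ ^ (vi.2 : ℕ)))
  choose mf hmf using hfi
  -- one layer `m` past all of them
  set m : ℕ := max n (max (Finset.univ.sup mc) (Finset.univ.sup mf)) with hm
  have hnm : n ≤ m := le_max_left _ _
  have hmc' : ∀ vi, mc vi ≤ m := fun vi ↦
    (Finset.le_sup (Finset.mem_univ vi)).trans ((le_max_left _ _).trans (le_max_right _ _))
  have hmf' : ∀ vi, mf vi ≤ m := fun vi ↦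
    (Finset.le_sup (Finset.mem_univ vi)).trans ((le_max_right _ _).trans (le_max_right _ _))
  set ym : W.subgroupH1 p (κ.layerSubgroup m) := W.resOfLe p (κ.layerSubgroup_antitone hnm) y with hym
  have hcm : W.layerToInfty κ m ym = W.layerToInfty κ n y := layerToInfty_resOfLe_layer W κ hnm y
  have hymA : ym ∈ W.selmerInftyPreimage κ m := by
    rw [W.mem_selmerInftyPreimage_iff, hcm]; exact hsel
  -- `res_{K_m/K_n} y ∈ Sel^ε(E/K_m)`
  have hmem : ym ∈ signedSelmerLayer W κ ε m := by
    rw [mem_signedSelmerLayer_iff]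
    constructor
    · -- the classical local conditions at layer `m`
      change ym ∈ W.selmerGroupOver p (κ.layerSubgroup m)
      rw [WeierstrassCurve.mem_selmerGroupOver_iff]
      refine ⟨fun v σ ↦ ?_, fun w σ ↦ ?_⟩
      · rw [WeierstrassCurve.mem_localKerOver_iff]
        by_cases hv : v ∈ S
        · -- descended from `K_∞` (§3)
          obtain ⟨i, hi, hiσ⟩ := exists_conjH1_eq_conjH1_pow_of_lt W κ hγ' n σ y
          rw [hym, conjH1_resOfLe_layer W κ hnm, hiσ, localResOver_resOfLe_layer W κ hnm]
          exact hmc (⟨v, hv⟩, ⟨i, hi⟩) m hnm (hmc' _)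
        · -- good `v ∉ S`, `v ∤ p`: `𝒦_{v,m}[p^∞] = 0` (Greenberg's Lemma 3.3)
          have hK := W.localResOver_conjH1_mem_localTowerKer_of_mem κ hymA v σ
          obtain ⟨k, hk⟩ := W.exists_pow_smul_subgroupH1_layer_eq_zero κ m (W.conjH1 p (κ.layerSubgroup m) σ ym)
          have hprim : W.localResOver p (κ.layerSubgroup m) (v.adicCompletion K)
              (W.conjH1 p (κ.layerSubgroup m) σ ym) ∈ W.localTowerKerPrimary κ (v.adicCompletion K) m :=
            (W.mem_localTowerKerPrimary_iff κ _ m _).2 ⟨hK, k, by rw [← map_nsmul, hk, map_zero]⟩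
          rw [Greenberg1999.localTowerKerPrimary_eq_bot_of_hasGoodReductionAt W κ (hS v hv).1 (hS v hv).2 m,
            AddSubgroup.mem_bot] at hprim
          exact hprim
      · -- archimedean places split completely
        rw [WeierstrassCurve.mem_localKerOver_iff]
        have hK := W.localResOver_conjH1_mem_localTowerKer_of_mem_infinitePlace κ hymA w σ
        rw [W.localTowerKer_eq_bot_of_forall_mem κ w.Completion m
          (ZpExtension.resGal_infinitePlace_mem_kerSubgroup κ w), AddSubgroup.mem_bot] at hK
        exact hK
    · -- the signed Kummer conditions at `v ∣ p`: torsion witnesses (§3–§4)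
      intro v hv σ
      have hvS : v ∈ S := by
        by_contra hvS
        exact (hS v hvS).1 hv
      obtain ⟨i, hi, hiσ⟩ := exists_conjH1_eq_conjH1_pow_of_lt W κ hγ' n σ y
      rw [hym, conjH1_resOfLe_layer W κ hnm, hiσ]
      refine mem_localKummerOverOfEmb_of_resOfLe_inf_decomp_eq_zero W p (κ.layerSubgroup m) v _ ?_
      have h := hmf (⟨⟨v, hvS⟩, hv⟩, ⟨i, hi⟩) m hnm (hmf' _)
      have hcomp := congrArg (fun f ↦ f (W.conjH1 p (κ.layerSubgroup n) (γ ^ i) y))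
        (W.resOfLe_comp_holds p (inf_le_left : κ.layerSubgroup m ⊓ decomp v ≤ κ.layerSubgroup m)
          (κ.layerSubgroup_antitone hnm))
      simp only [AddMonoidHom.coe_comp, Function.comp_apply] at hcomp
      rw [hcomp]
      exact h
  -- `c = h_m(res y) ∈ ⋃ₙ hₙ(Sel^ε(E/K_n))`
  rw [← hcm]
  exact map_layerToInfty_signedSelmerLayer_le W κ ε m ⟨ym, hmem, rfl⟩

/-- Pointwise corollary for the finiteness transfers: if the `p`-torsion classes of `Sel^ε(E/K_∞)`
form a finite set, so do those of `Sel₀(K_∞, E[p^∞])` (the inclusion restricted to `p`-torsion is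
injective). [cite: CoatesSujatha2005, §3] [cite: Kobayashi2003, Def. 1.1] -/
theorem finite_fineSelmerInfty_pTorsion_of_finite_signedSelmerInfty_pTorsion [W.IsElliptic]
    (S : Finset (HeightOneSpectrum (𝓞 K)))
    (hS : ∀ v ∉ S, ((p : ℕ) : 𝓞 K) ∉ v.asIdeal ∧ W.HasGoodReductionAt v) (ε : ℤˣ)
    (hfin : Set.Finite {s : signedSelmerInfty W κ ε | p • s = 0}) :
    Set.Finite {s : W.fineSelmerInfty κ | p • s = 0} := by
  let f : W.fineSelmerInfty κ → signedSelmerInfty W κ ε :=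
    fun s ↦ ⟨(s : W.subgroupH1 p κ.kerSubgroup), fineSelmerInfty_le_signedSelmerInfty W κ S hS ε s.2⟩
  have hf : Function.Injective f := fun s t hst ↦
    Subtype.ext (congrArg (fun z : signedSelmerInfty W κ ε ↦ (z : W.subgroupH1 p κ.kerSubgroup)) hst)
  refine (hfin.preimage hf.injOn).subset fun s hs ↦ ?_
  rw [Set.mem_setOf_eq] at hs
  rw [Set.mem_preimage, Set.mem_setOf_eq]
  have h1 : ((p • s : W.fineSelmerInfty κ) : W.subgroupH1 p κ.kerSubgroup) = 0 := by
    rw [hs]; rfl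
  rw [AddSubgroupClass.coe_nsmul] at h1
  apply Subtype.ext
  rw [AddSubgroupClass.coe_nsmul]
  exact h1

end Main

/-! ## §6 (A) at `(W′, p)` from the finiteness of `Sel^ε(W′/K_∞)[p]` — the supersingular-anchor entry point -/

section ConjA

open WeierstrassCurve Literature.NumberTheory.EllipticCurves.IwasawaAlgebra
  Summit.BirchSwinnertonDyer.Rank1Residual

variable {K : Type u} [Field K] [NumberField K] (W : WeierstrassCurve K) [W.IsElliptic] {p : ℕ}
  [Fact p.Prime] (κ : ZpExtension K p)

/-- **(A) from the finiteness of `Sel₀(K_∞, E[p^∞])[p]`** (the step shared by every anchor type;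
g3's `WildFineSelmerOrdinaryAnchor.conjA_of_finite_selmerInfty_pTorsion` inlines it after `Sel₀ ≤ Sel`):
for `W/K` elliptic, `κ` a `ℤ_p`-extension with topological generator `γ`, if the `p`-torsion classes of
the fine Selmer group form a finite set then its Pontryagin dual `X₀` is finitely generated over `ℤ_p`
— Coates–Sujatha's (A) at `(W, p)` over `K_∞` in the tree's `∃`-form. Chain: `X₀/(p)` finite
(`FineSelmerDualData.finite_quotient_augIdealP_of_finite_pTorsion`) ⟹ (`X₀` f.g./`Λ`,
`FineSelmerDualData.module_finite`) torsion (`Iwasawa.isTorsion_of_finite_modN`) with `μ(X₀) = 0`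
(`X2.MuVanishingOfFiniteModP`) ⟹ f.g./`ℤ_p` (`X2.NonPrimitiveSelmerTorsionCard`). Unconditional.
[cite: CoatesSujatha2005, §3 (Conjecture A and Lemma 3.1)] [cite: GreenbergLNM1716, §1 p. 60] -/
theorem conjA_of_finite_fineSelmerInfty_pTorsion {γ : absoluteGaloisGroup K} (hγ : κ.IsTopGenerator γ)
    (h0 : Set.Finite {s : W.fineSelmerInfty κ | p • s = 0}) :
    ∃ (γ' : absoluteGaloisGroup K) (D : W.FineSelmerDualData κ γ'),
      Module.Finite ℤ_[p] (RestrictScalars ℤ_[p] (IwasawaAlgebra p) D.X) := by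
  let D : W.FineSelmerDualData κ γ := W.fineSelmerDualData κ hγ
  haveI hfg : Module.Finite (IwasawaAlgebra p) D.X := FineSelmerDualData.module_finite (W := W) κ hγ D
  have hq : Finite (D.X ⧸ (augIdealP p • (⊤ : Submodule (IwasawaAlgebra p) D.X))) :=
    D.finite_quotient_augIdealP_of_finite_pTorsion h0
  have hmodN : Finite (ModN D.X p) := by
    apply Nat.finite_of_card_ne_zero
    rw [← Iwasawa.natCard_quotient_augIdealP_smul_top_eq_natCard_modN p]
    exact (Nat.card_pos (α := D.X ⧸ (augIdealP p • (⊤ : Submodule (IwasawaAlgebra p) D.X)))).ne'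
  haveI := hmodN
  have hT : Module.IsTorsion (IwasawaAlgebra p) D.X := Iwasawa.isTorsion_of_finite_modN p D.X
  have hμ : muInvariant p D.X = 0 :=
    X2.MuVanishingOfFiniteModP.muInvariant_eq_zero_of_finite_modN' p D.X hT hmodN
  exact ⟨γ, D, X2.NonPrimitiveSelmerTorsionCard.moduleFinite_int_of_muInvariant_eq_zero p D.X hT hμ⟩

/-- **Coates–Sujatha's (A) in the kernel from SIGNED `μ = 0` (with cotorsion).** For an elliptic curve
`W/K` over a number field, a prime `p`, a `ℤ_p`-extension `κ` with topological generator `γ`, a sign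
`ε` and a finite set `S` of finite places off which `W` is good and `v ∤ p`: if the `p`-torsion classes
of Kobayashi's `Sel^ε(W/K_∞)` form a finite set (e.g. `X^ε` is `Λ`-torsion with `μ = 0` — Kobayashi
Thm. 1.2 / Pollack–Rubin + a unit coefficient of the signed `p`-adic `L`-function), then the Pontryagin
dual of the fine Selmer group is finitely generated over `ℤ_p`: (A) at `(W, p)` over `K_∞` in the tree's
`∃`-form (`Sel₀ ≤ Sel^ε`, §5, then `conjA_of_finite_fineSelmerInfty_pTorsion`). Unconditional kernel
theorem — the supersingular twin of g3/g4's `WildFineSelmerOrdinaryAnchor.conjA_of_finite_selmerInfty_pTorsion`.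
[cite: CoatesSujatha2005, §3 (Conjecture A)] [cite: Kobayashi2003, Thm. 1.2 and Def. 1.1]
[cite: PollackRubin2004, Theorem (p. 448)] -/
theorem conjA_of_finite_signedSelmerInfty_pTorsion (S : Finset (HeightOneSpectrum (𝓞 K)))
    (hS : ∀ v ∉ S, ((p : ℕ) : 𝓞 K) ∉ v.asIdeal ∧ W.HasGoodReductionAt v) (ε : ℤˣ)
    {γ : absoluteGaloisGroup K} (hγ : κ.IsTopGenerator γ)
    (hfin : Set.Finite {s : signedSelmerInfty W κ ε | p • s = 0}) :
    ∃ (γ' : absoluteGaloisGroup K) (D : W.FineSelmerDualData κ γ'),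
      Module.Finite ℤ_[p] (RestrictScalars ℤ_[p] (IwasawaAlgebra p) D.X) :=
  conjA_of_finite_fineSelmerInfty_pTorsion W κ hγ
    (finite_fineSelmerInfty_pTorsion_of_finite_signedSelmerInfty_pTorsion W κ S hS ε hfin)

/-- Variant over `ℚ` quantified over all cyclotomic data, in the exact `∃`-form of the crux and of the
Lim–Sujatha transfer: if for every cyclotomic `ℤ_p`-extension datum `κ` the `p`-torsion of
`Sel^ε(W/ℚ_∞)` is finite, then (A) at `(W, p)` (a topological generator always exists). The finite bad
set is `S ∪ {p}` for any `S` carrying the bad places. [cite: CoatesSujatha2005, §3 (Conjecture A)]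
[cite: Kobayashi2003, Thm. 1.2] -/
theorem conjA_rat_of_finite_signedSelmerInfty_pTorsion (W : WeierstrassCurve ℚ) [W.IsElliptic]
    {p : ℕ} [Fact p.Prime] (S : Finset (HeightOneSpectrum (𝓞 ℚ)))
    (hS : ∀ v ∉ S, ((p : ℕ) : 𝓞 ℚ) ∉ v.asIdeal ∧ W.HasGoodReductionAt v) (ε : ℤˣ)
    (hfin : ∀ (κ : ZpExtension ℚ p), κ.IsCyclotomic →
      Set.Finite {s : signedSelmerInfty W κ ε | p • s = 0}) :
    ∀ (κ : ZpExtension ℚ p), κ.IsCyclotomic →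
      ∃ (γ : absoluteGaloisGroup ℚ) (D : W.FineSelmerDualData κ γ),
        Module.Finite ℤ_[p] (RestrictScalars ℤ_[p] (IwasawaAlgebra p) D.X) := by
  intro κ hκ
  obtain ⟨γ, hγ⟩ : ∃ γ : absoluteGaloisGroup ℚ, κ.IsTopGenerator γ :=
    κ.surjective (Multiplicative.ofAdd 1)
  exact conjA_of_finite_signedSelmerInfty_pTorsion W κ S hS ε hγ (hfin κ hκ)

end ConjA

end Summit.BirchSwinnertonDyer.BirchSwinnertonDyer.Theorems.FineSelmerLeSignedSelmer

end
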